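import Literature.NumberTheory.Automorphic.ShimuraCurveTakahashiCoordinateInputs
import Literature.NumberTheory.Automorphic.ShimuraParametrizationSplitDegreeProofs
import Literature.NumberTheory.Automorphic.ShimuraCurveDataExistence
import Literature.NumberTheory.Automorphic.ShimuraCurveRibetTakahashiSemistableManinProofs
import Literature.NumberTheory.EllipticCurves.TakahashiDegreeFormula
import Literature.NumberTheory.EllipticCurves.CuspFormLFunctionLevelConductorProofs
import Literature.NumberTheory.EllipticCurves.IsogenyIdProofs
import Literature.NumberTheory.EllipticCurves.IsogenyConductorModularityProofs
import Summits.ABC.ABC.Theorems.DefiniteXiFreyModularity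
import HarnessLib

/-!
# stub_takahashi (crux `DefiniteXi.DefiniteRTControlPrime`, stmt-ABC-11338) — gen-3 k1 companion:
# the ABC-idiom named fact `takahashi2001_thm_2_3_of_coprime` is a COROLLARY of the BSD-idiom twin
# `takahashi2001_thm_2_3_shimura_level` at `D = 1`, through the tree's `X₀^1(N) = X₀(N)` bridges

`lean check`: rc 0, **0 sorries**, axioms `propext, Classical.choice, Quot.sound`.

* `LevelIsConductor N` — the (D2) input "a curve carrying a level-`N` classical datum has conductor
  `N`", with four dischargers: `levelIsConductor_of_squarefree` (UNCONDITIONAL at squarefree `N`,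
  tree `IsNewformOf.level_eq_conductorNorm_of_squarefree_level`), `_of_carayol` (named fact
  `IsNewformOf.level_eq_conductorNorm`), `_of_exists_isNewformOf`, `_of_modularity`
  (`nonempty_modularParametrizationData`, the fact route DefiniteXi already carries via FreyModularity).
* H2 `classMinimal_of_conductorMinimal`, H3 `isMinimalFor_of_classMinimal` — the stub's
  conductor-restricted minimality ⇒ `ShimuraParametrizationData.IsMinimalFor` for the transported datum.
* `of_shimura_level : twin → (∀ N, LevelIsConductor N) → takahashi2001_thm_2_3_of_coprime`;
  `of_shimura_level_squarefree` (the stub at squarefree `M r` from the twin ALONE);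
  `of_shimura_level_of_carayol`, `of_shimura_level_of_exists_isNewformOf`, `of_shimura_level_of_modularity`.

Tree bridges used: `nonempty_shimuraCurveData_holds`, `isAdmissibleFactorization_one`,
`exists_shimuraParametrizationData_deg_eq_modularDegree`, `ShimuraParametrizationData.modularDegree_dvd_deg`,
`IsNewformOf.level_eq_level`, `WeierstrassCurve.isIsogenous_self`. This corrects gen-2 k1's dedup note
("no implication either way (different data types)"): twin(D = 1) ⟹ stub.
-/

noncomputable section

namespace Summit.ABC.ABC.Cruxes.DefiniteRTControlPrime.StubIdeas1G3

open Literature.NumberTheory.Automorphic Literature.NumberTheory.EllipticCurves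
  Literature.NumberTheory.EllipticCurves.ModularForms

/-- (D2) input at level `N`: every elliptic curve carrying a classical datum at level `N` has
conductor `N` (Carayol's level theorem restricted to the curves that occur). -/
def LevelIsConductor (N : ℕ) [NeZero N] : Prop :=
  ∀ (W : WeierstrassCurve ℚ) [W.IsElliptic] (_D : ModularParametrizationData W N), N = W.conductorNorm ℤ

/-- H1a — unconditional at squarefree level (tree: `IsNewformOf.level_eq_conductorNorm_of_squarefree_level`). -/
theorem levelIsConductor_of_squarefree {N : ℕ} [NeZero N] (hN : Squarefree N) : LevelIsConductor N :=
  fun _W _ D => D.isNewformOf.level_eq_conductorNorm_of_squarefree_level hN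

/-- H1b — from the named fact `IsNewformOf.level_eq_conductorNorm` (Carayol) at level `N`. -/
theorem levelIsConductor_of_carayol {N : ℕ} [NeZero N]
    (h : IsNewformOf.level_eq_conductorNorm (N := N)) : LevelIsConductor N :=
  fun _W _ D => h D.isNewformOf

/-- H1c — from modularity in the tree's form `exists_isNewformOf` (tree:
`IsNewformOf.level_eq_conductorNorm_of_exists_isNewformOf`). -/
theorem levelIsConductor_of_exists_isNewformOf (h : exists_isNewformOf) {N : ℕ} [NeZero N] :
    LevelIsConductor N :=
  fun _W _ D => IsNewformOf.level_eq_conductorNorm_of_exists_isNewformOf h D.isNewformOf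

/-- H1d — from modularity in the DATA form the route already carries (`nonempty_modularParametrizationData`,
item FreyModularity's source fact): transport `D` to a global minimal model `C • W`
(`nonempty_modularParametrizationData_smul_iff`), compare levels with the conductor-level datum of
`C • W` (`level_eq_level`, strong multiplicity one — a tree theorem), `N_{C•W} = N_W`. -/
theorem levelIsConductor_of_modularity (hmod : nonempty_modularParametrizationData) {N : ℕ} [NeZero N] :
    LevelIsConductor N := by
  intro W _ D
  obtain ⟨C, hC⟩ := WeierstrassCurve.hasGlobalMinimalModel_rat_holds W
  haveI := hC
  haveI : NeZero ((C • W).conductorNorm ℤ) := ⟨((C • W).conductorNorm_pos_holds).ne'⟩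
  obtain ⟨D'⟩ := hmod (C • W)
  obtain ⟨D₁⟩ := (Summit.ABC.ABC.Theorems.nonempty_modularParametrizationData_smul_iff C).mpr ⟨D⟩
  rw [D₁.isNewformOf.level_eq_level D'.isNewformOf, WeierstrassCurve.conductorNorm_smul_rat]

/-- H2 — conductor-restricted minimality (the stub's hypothesis) ⇒ class minimality (the idiom of the
`D = 1` bridges), given (D2). -/
theorem classMinimal_of_conductorMinimal {N : ℕ} [NeZero N] (hLC : LevelIsConductor N)
    {W : WeierstrassCurve ℚ} (P : ModularParametrizationData W N)
    (hmin : ∀ (W' : WeierstrassCurve ℚ) [W'.IsElliptic], W'.conductorNorm ℤ = N →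
      ∀ P' : ModularParametrizationData W' N, P'.f = P.f → P.modularDegree ≤ P'.modularDegree) :
    ∀ (W₂ : WeierstrassCurve ℚ) [W₂.IsElliptic] (D₂ : ModularParametrizationData W₂ N),
      D₂.f = P.f → P.modularDegree ≤ D₂.modularDegree :=
  fun W₂ _ D₂ hD₂ => hmin W₂ (hLC W₂ D₂).symm D₂ hD₂

/-- H3 — a Shimura datum on `W` itself of degree `deg P`, with `P` class-minimal, realises
`δ_{1,N}(W)` (`IsMinimalFor W`): every Shimura datum of a curve of the class has degree divisible by
`deg P` (tree: `ShimuraParametrizationData.modularDegree_dvd_deg`). -/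
theorem isMinimalFor_of_classMinimal {N : ℕ} [NeZero N] {X : ShimuraCurveData 1 N}
    {W : WeierstrassCurve ℚ} [W.IsElliptic] (P : ModularParametrizationData W N)
    (hminP : ∀ (W₂ : WeierstrassCurve ℚ) [W₂.IsElliptic] (D₂ : ModularParametrizationData W₂ N),
      D₂.f = P.f → P.modularDegree ≤ D₂.modularDegree)
    (Q : ShimuraParametrizationData X W) (hQ : Q.deg = P.modularDegree) : Q.IsMinimalFor W :=
  ⟨WeierstrassCurve.isIsogenous_self W, fun W'' _ P'' hiso => by
    rw [hQ]
    exact Nat.le_of_dvd P''.deg_pos (P''.modularDegree_dvd_deg hiso P P.isNewformOf hminP)⟩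

/-- ASSEMBLY — `takahashi2001_thm_2_3_of_coprime` from the `X₀^D(M)` twin at `D = 1` and (D2):
`X : ShimuraCurveData 1 (Mr)` exists (`nonempty_shimuraCurveData_holds`), `P` transports to a Shimura
datum `Q` on `W` with `deg Q = deg P` (`exists_shimuraParametrizationData_deg_eq_modularDegree`),
`Q.IsMinimalFor W` (H2, H3), and the twin at `(N, D, M, p, m) = (Mr, 1, Mr, r, M)` is the stub's
conclusion for `W` (Brandt type `(M, 1·r) = (M, r)`). -/
theorem of_shimura_level (hT : takahashi2001_thm_2_3_shimura_level)
    (hLC : ∀ (N : ℕ) [NeZero N], LevelIsConductor N) : takahashi2001_thm_2_3_of_coprime := by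
  intro W _ M r _ hr hcop hWN P hPmin S
  have hpos : 0 < M * r := Nat.pos_of_ne_zero (NeZero.ne _)
  have hadm : IsAdmissibleFactorization (M * r) 1 (M * r) := isAdmissibleFactorization_one hpos
  obtain ⟨X⟩ := nonempty_shimuraCurveData_holds hadm
  obtain ⟨Q, hQ⟩ := exists_shimuraParametrizationData_deg_eq_modularDegree X P
  have hminP := classMinimal_of_conductorMinimal (hLC (M * r)) P hPmin
  have hQmin : Q.IsMinimalFor W := isMinimalFor_of_classMinimal P hminP Q hQ
  have hrM : ¬ r ∣ M := by
    intro h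
    have hg : Nat.gcd M r = 1 := hcop
    have h1 : r ∣ Nat.gcd M r := Nat.dvd_gcd h (dvd_refl r)
    rw [hg] at h1
    exact hr.one_lt.ne' (Nat.dvd_one.mp h1)
  have key := hT hr (Nat.mul_comm M r) hrM hadm X W hWN W Q hQmin
  rw [Nat.one_mul] at key
  obtain ⟨i, j, hi, hij, hdvd, hδ⟩ := key S
  exact ⟨i, j, hi, hij, hdvd, by rw [← hQ]; exact hδ⟩

/-- The stub at SQUAREFREE level `M r` (semistable Frey curves) from the twin ALONE. -/
theorem of_shimura_level_squarefree (hT : takahashi2001_thm_2_3_shimura_level) :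
    ∀ (W : WeierstrassCurve ℚ) [W.IsElliptic] (M r : ℕ) [NeZero (M * r)], Squarefree (M * r) →
    r.Prime → M.Coprime r → W.conductorNorm ℤ = M * r →
    ∀ P : ModularParametrizationData W (M * r),
      (∀ (W' : WeierstrassCurve ℚ) [W'.IsElliptic], W'.conductorNorm ℤ = M * r →
          ∀ P' : ModularParametrizationData W' (M * r),
          P'.f = P.f → P.modularDegree ≤ P'.modularDegree) →
      ∀ S : Brandt.XiSetup M r,
        ∃ i j : ℕ, 0 < i ∧ i * j = (W.minimalDiscriminantNorm ℤ).factorization r ∧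
          i ∣ S.xi (fun n => W.LFunction n) ∧
          P.modularDegree * i = S.xi (fun n => W.LFunction n) * j := by
  intro W _ M r _ hsq hr hcop hWN P hPmin S
  have hpos : 0 < M * r := Nat.pos_of_ne_zero (NeZero.ne _)
  have hadm : IsAdmissibleFactorization (M * r) 1 (M * r) := isAdmissibleFactorization_one hpos
  obtain ⟨X⟩ := nonempty_shimuraCurveData_holds hadm
  obtain ⟨Q, hQ⟩ := exists_shimuraParametrizationData_deg_eq_modularDegree X P
  have hminP := classMinimal_of_conductorMinimal (levelIsConductor_of_squarefree hsq) P hPmin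
  have hQmin : Q.IsMinimalFor W := isMinimalFor_of_classMinimal P hminP Q hQ
  have hrM : ¬ r ∣ M := by
    intro h
    have hg : Nat.gcd M r = 1 := hcop
    have h1 : r ∣ Nat.gcd M r := Nat.dvd_gcd h (dvd_refl r)
    rw [hg] at h1
    exact hr.one_lt.ne' (Nat.dvd_one.mp h1)
  have key := hT hr (Nat.mul_comm M r) hrM hadm X W hWN W Q hQmin
  rw [Nat.one_mul] at key
  obtain ⟨i, j, hi, hij, hdvd, hδ⟩ := key S
  exact ⟨i, j, hi, hij, hdvd, by rw [← hQ]; exact hδ⟩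

/-- The stub from the twin and Carayol's level theorem (named fact) at every level. -/
theorem of_shimura_level_of_carayol (hT : takahashi2001_thm_2_3_shimura_level)
    (hCar : ∀ (N : ℕ) [NeZero N], IsNewformOf.level_eq_conductorNorm (N := N)) :
    takahashi2001_thm_2_3_of_coprime :=
  of_shimura_level hT fun N _ => levelIsConductor_of_carayol (hCar N)

/-- The stub from the twin and modularity `exists_isNewformOf` (named fact). -/
theorem of_shimura_level_of_exists_isNewformOf (hT : takahashi2001_thm_2_3_shimura_level)
    (hmod : exists_isNewformOf) : takahashi2001_thm_2_3_of_coprime :=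
  of_shimura_level hT fun _N _ => levelIsConductor_of_exists_isNewformOf hmod

/-- The stub from the twin and modularity in the data form `nonempty_modularParametrizationData`
(the named fact route DefiniteXi already depends on, item FreyModularity). -/
theorem of_shimura_level_of_modularity (hT : takahashi2001_thm_2_3_shimura_level)
    (hmod : nonempty_modularParametrizationData) : takahashi2001_thm_2_3_of_coprime :=
  of_shimura_level hT fun _N _ => levelIsConductor_of_modularity hmod

end Summit.ABC.ABC.Cruxes.DefiniteRTControlPrime.StubIdeas1G3

end
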